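import Summits.NavierStokesRegularity.FunctionalMining.NoGo.LogThresholdSupNorm
import Summits.NavierStokesRegularity.FunctionalMining.NoGo.LogDoorWitness
import HarnessLib

/-!
# The log-door background `G_n`: exponential-in-`n` bounds for `∫‖ΔG_n‖²`, `∫‖∇ΔG_n‖²`, `|P₂(G_n)|`

Search for candidate a priori estimates; no regularity claim. NS FUNCTIONAL MINING — NO-GO BRANCH
(cell `pub-nsfunc`, prove seat gen 4). The no-go N6 (`NoGo/PalinstrophySupRateRefutation.lean`)
never needed the SIZE of the background's own palinstrophy `∫‖ΔG_n‖²` or self-production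
`P₂(G_n) = ∫⟪DG_n(G_n), Δ²G_n⟫` (amplitude scaling removed them); the log door does (they enter
the logarithm). Here:
* `unitBackground η` — the one-step field `𝔅 = ((xβ(Q) + 2xy²β'(Q))η(z), −(yβ(Q) + 2x²yβ'(Q))η(z), 0)`;
* `background_eq_sum_dil`: `G_n = Σ_{j<n} λ_j⁻¹ 𝔅 ∘ dilH λ_j`, `λ_j = 2^{j+1}` (the staircase
  `H_n = Σ β(4^{j+1}·)` is linear in the step, and each step is a horizontal dilate of `β(Q)`);
* `norm_iteratedFDeriv_background_le`: `‖DᵏG_n(x)‖ ≤ c_k (2^{k+1})ⁿ` (chain rule for `dilH`,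
  `‖dilH λ‖ ≤ λ`, and `sup ‖Dᵏ𝔅‖ < ∞` by compact support);
* `background_sobolev_bounds`: `∫‖ΔG_n‖²`, `∫ Σᵢ‖∂ᵢΔG_n‖²`, `|P₂(G_n)|` are all `≤ κ · 256ⁿ`
  for one constant `κ` (existential: it involves `sup|β⁽ᵏ⁾|`, `k ≤ 5`).
Folklore calculus; nothing is asserted about Navier–Stokes.
-/

noncomputable section

open MeasureTheory Set Function Filter
open scoped ContDiff Topology Laplacian InnerProductSpace RealInnerProductSpace

namespace Summit.NavierStokesRegularity.FunctionalMining

namespace Sep3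

open Literature.Analysis.FluidPDE LogDoor

/-- `k ≤ ∞` in `WithTop ℕ∞` for a natural number `k`. [folklore] -/
private theorem natCast_le_inftyB (k : ℕ) : (k : WithTop ℕ∞) ≤ ∞ := by exact_mod_cast le_top

/-! ## The one-step field `𝔅` -/

variable (η : ℝ → ℝ)

/-- Components of the one-step field: `UG` with the staircase `H_n` replaced by the single
undilated step `β(Q)` (`β' = iteratedDeriv 1 stepB`). [folklore] -/
def UB : Fin 3 → E3 → ℝ :=
  ![fun y => (y 0 * stepB (Qr y) + 2 * y 0 * y 1 ^ 2 * iteratedDeriv 1 stepB (Qr y)) * η (y 2),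
    fun y => -((y 1 * stepB (Qr y) + 2 * y 0 ^ 2 * y 1 * iteratedDeriv 1 stepB (Qr y)) * η (y 2)),
    fun _ => 0]

/-- The one-step field `𝔅` on `ℝ³`. [folklore] -/
def unitBackground : E3 → E3 := vec3 (UB η)

/-- Component `0` of `𝔅`. [folklore] -/
theorem UB_zero_apply (y : E3) :
    UB η 0 y = (y 0 * stepB (Qr y) + 2 * y 0 * y 1 ^ 2 * iteratedDeriv 1 stepB (Qr y)) * η (y 2) := rfl
/-- Component `1` of `𝔅`. [folklore] -/
theorem UB_one_apply (y : E3) :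
    UB η 1 y = -((y 1 * stepB (Qr y) + 2 * y 0 ^ 2 * y 1 * iteratedDeriv 1 stepB (Qr y)) * η (y 2)) := rfl
/-- Component `2` of `𝔅`. [folklore] -/
theorem UB_two_apply (y : E3) : UB η 2 y = 0 := rfl

variable {η}

/-- The components of `𝔅` are smooth. [folklore] -/
theorem contDiff_UB (hη : ContDiff ℝ ∞ η) (i : Fin 3) : ContDiff ℝ ∞ (UB η i) := by
  have hH : ContDiff ℝ ∞ (fun y : E3 => stepB (Qr y)) := stepB_contDiff.comp contDiff_Qr
  have hH' : ContDiff ℝ ∞ (fun y : E3 => iteratedDeriv 1 stepB (Qr y)) :=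
    (contDiff_iteratedDeriv stepB_contDiff 1).comp contDiff_Qr
  have hηc : ContDiff ℝ ∞ (fun y : E3 => η (y 2)) := hη.comp (crd3 2).contDiff
  have h0 : ContDiff ℝ ∞ (fun y : E3 => y 0) := (crd3 0).contDiff
  have h1 : ContDiff ℝ ∞ (fun y : E3 => y 1) := (crd3 1).contDiff
  obtain rfl | rfl | rfl : i = 0 ∨ i = 1 ∨ i = 2 := by fin_cases i <;> simp
  · exact ((h0.mul hH).add (((contDiff_const.mul h0).mul (h1.pow 2)).mul hH')).mul hηc
  · exact (((h1.mul hH).add (((contDiff_const.mul (h0.pow 2)).mul h1).mul hH')).mul hηc).neg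
  · exact contDiff_const

/-- `𝔅` is smooth. [folklore] -/
theorem contDiff_unitBackground (hη : ContDiff ℝ ∞ η) : ContDiff ℝ ∞ (unitBackground η) :=
  contDiff_vec3 (contDiff_UB hη)

/-- `𝔅` vanishes where `Q > 4` or `|y₂| > 1` (for `η = etaZ`). [folklore] -/
theorem unitBackground_eq_zero {y : E3} (hy : 4 < Qr y ∨ 1 < |y 2|) : unitBackground etaZ y = 0 := by
  ext i
  rw [unitBackground, vec3_apply, PiLp.zero_apply]
  rcases hy with h | h
  · have hβ : stepB (Qr y) = 0 := stepB_eq_zero (by rw [abs_of_nonneg (Qr_nonneg y)]; exact h.le)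
    have hβ' : iteratedDeriv 1 stepB (Qr y) = 0 :=
      iteratedDeriv_stepB_eq_zero 0 (Or.inr (by rw [abs_of_nonneg (Qr_nonneg y)]; exact h))
    obtain rfl | rfl | rfl : i = 0 ∨ i = 1 ∨ i = 2 := by fin_cases i <;> simp
    · rw [UB_zero_apply, hβ, hβ']; ring
    · rw [UB_one_apply, hβ, hβ']; ring
    · rfl
  · have hη : etaZ (y 2) = 0 := etaZ_eq_zero h
    obtain rfl | rfl | rfl : i = 0 ∨ i = 1 ∨ i = 2 := by fin_cases i <;> simp
    · rw [UB_zero_apply, hη]; ring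
    · rw [UB_one_apply, hη]; ring
    · rfl

/-- `𝔅` is supported in the closed ball of radius `3`. [folklore] -/
theorem tsupport_unitBackground : tsupport (unitBackground etaZ) ⊆ Metric.closedBall 0 3 := by
  refine closure_minimal (fun y hy => ?_) Metric.isClosed_closedBall
  rw [Metric.mem_closedBall, dist_zero_right]
  by_contra hnorm
  push Not at hnorm
  have hsq : 9 < ‖y‖ ^ 2 := by nlinarith [norm_nonneg y]
  rw [EuclideanSpace.norm_sq_eq, Fin.sum_univ_three] at hsq
  simp only [Real.norm_eq_abs, sq_abs] at hsq
  apply hy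
  apply unitBackground_eq_zero
  by_contra hc
  rw [not_or, not_lt, not_lt] at hc
  have h2 : y 2 ^ 2 ≤ 1 := by rw [← sq_abs]; nlinarith [abs_nonneg (y 2), hc.2]
  unfold Qr at hc
  linarith [hc.1]

/-- `𝔅` has compact support. [folklore] -/
theorem hasCompactSupport_unitBackground : HasCompactSupport (unitBackground etaZ) :=
  HasCompactSupport.of_support_subset_isCompact (isCompact_closedBall 0 3)
    (subset_closure.trans tsupport_unitBackground)

/-! ## `G_n` as a sum of horizontal dilates of `𝔅` -/

/-- Components of a finite sum of vectors of `ℝ³`. [folklore] -/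
theorem finset_sum_apply3 {ι : Type*} (s : Finset ι) (v : ι → E3) (i : Fin 3) :
    (∑ j ∈ s, v j) i = ∑ j ∈ s, v j i := by
  classical
  induction s using Finset.induction_on with
  | empty => simp
  | insert a s ha ih => rw [Finset.sum_insert ha, Finset.sum_insert ha, PiLp.add_apply, ih]

/-- `Q(dilH λ y) = λ² Q(y)`. [folklore] -/
theorem Qr_dilH (lam : ℝ) (y : E3) : Qr (dilH lam y) = lam ^ 2 * Qr y := by
  obtain ⟨h0, h1, -⟩ := dilH_apply lam y
  unfold Qr; rw [h0, h1]; ring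

/-- `(2^{j+1})² = 4^{j+1}`. [folklore] -/
theorem two_pow_sq (j : ℕ) : ((2 : ℝ) ^ (j + 1)) ^ 2 = 4 ^ (j + 1) := by
  rw [← pow_mul, show (4 : ℝ) = 2 ^ 2 by norm_num, ← pow_mul]; ring_nf

/-- **The dilation decomposition**: `G_n(y) = Σ_{j<n} (2^{j+1})⁻¹ 𝔅(dilH 2^{j+1} y)`. [folklore] -/
theorem background_eq_sum_dil (n : ℕ) :
    background n η = fun y => ∑ j ∈ Finset.range n,
      ((2 : ℝ) ^ (j + 1))⁻¹ • unitBackground η (dilH (2 ^ (j + 1)) y) := by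
  funext y
  ext i
  rw [finset_sum_apply3]
  simp only [PiLp.smul_apply, smul_eq_mul, unitBackground, vec3_apply, background]
  have hQ : ∀ j : ℕ, Qr (dilH ((2 : ℝ) ^ (j + 1)) y) = 4 ^ (j + 1) * Qr y := fun j => by
    rw [Qr_dilH, two_pow_sq]
  obtain rfl | rfl | rfl : i = 0 ∨ i = 1 ∨ i = 2 := by fin_cases i <;> simp
  · rw [UG_zero_apply, coreH, deriv_coreH]
    simp only [UB_zero_apply, hQ, (dilH_apply _ y).1, (dilH_apply _ y).2.1, (dilH_apply _ y).2.2]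
    rw [Finset.mul_sum, Finset.mul_sum, ← Finset.sum_add_distrib, Finset.sum_mul]
    refine Finset.sum_congr rfl fun j _ => ?_
    have h2 : (2 : ℝ) ^ (j + 1) ≠ 0 := pow_ne_zero _ two_ne_zero
    rw [← two_pow_sq j]
    field_simp
  · rw [UG_one_apply, coreH, deriv_coreH]
    simp only [UB_one_apply, hQ, (dilH_apply _ y).1, (dilH_apply _ y).2.1, (dilH_apply _ y).2.2]
    rw [Finset.mul_sum, Finset.mul_sum, ← Finset.sum_add_distrib, Finset.sum_mul, ← Finset.sum_neg_distrib]
    refine Finset.sum_congr rfl fun j _ => ?_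
    have h2 : (2 : ℝ) ^ (j + 1) ≠ 0 := pow_ne_zero _ two_ne_zero
    rw [← two_pow_sq j]
    field_simp
  · rw [show UG n η 2 y = 0 from rfl]
    simp [UB_two_apply]

/-! ## Sup-norm bounds for the derivatives of `G_n` -/

/-- **`‖DᵏG_n(x)‖ ≤ c_k · (2^{k+1})ⁿ`** with `c_k = sup ‖Dᵏ𝔅‖`. [folklore] -/
theorem norm_iteratedFDeriv_background_le (k : ℕ) :
    ∃ c : ℝ, 0 ≤ c ∧ ∀ (n : ℕ) (x : E3),
      ‖iteratedFDeriv ℝ k (background n etaZ) x‖ ≤ c * ((2 : ℝ) ^ (k + 1)) ^ n := by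
  obtain ⟨c, hc0, hc⟩ := exists_bound_iteratedFDeriv_of_hasCompactSupport
    (contDiff_unitBackground etaZ_contDiff) hasCompactSupport_unitBackground k
  refine ⟨c, hc0, fun n x => ?_⟩
  have hB := contDiff_unitBackground etaZ_contDiff
  have hterm : ∀ j ∈ Finset.range n, ContDiff ℝ k (fun y : E3 =>
      ((2 : ℝ) ^ (j + 1))⁻¹ • unitBackground etaZ (dilH (2 ^ (j + 1)) y)) := fun j _ =>
    ((hB.comp (dilH _).contDiff).of_le (natCast_le_inftyB k)).const_smul _
  rw [background_eq_sum_dil, iteratedFDeriv_sum hterm, Finset.sum_apply]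
  refine (norm_sum_le _ _).trans ?_
  calc ∑ j ∈ Finset.range n, ‖iteratedFDeriv ℝ k (fun y : E3 =>
          ((2 : ℝ) ^ (j + 1))⁻¹ • unitBackground etaZ (dilH (2 ^ (j + 1)) y)) x‖
      ≤ ∑ j ∈ Finset.range n, c * ((2 : ℝ) ^ (j + 1)) ^ k := by
        refine Finset.sum_le_sum fun j _ => ?_
        have hl : (1 : ℝ) ≤ 2 ^ (j + 1) := one_le_pow₀ (by norm_num)
        have hl0 : (0 : ℝ) < 2 ^ (j + 1) := by positivity
        have hcd : ContDiff ℝ k (fun y : E3 => unitBackground etaZ (dilH (2 ^ (j + 1)) y)) :=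
          (hB.comp (dilH _).contDiff).of_le (natCast_le_inftyB k)
        rw [iteratedFDeriv_const_smul_apply' hcd.contDiffAt, norm_smul,
          norm_inv, Real.norm_of_nonneg hl0.le]
        calc ((2 : ℝ) ^ (j + 1))⁻¹ * ‖iteratedFDeriv ℝ k (fun y => unitBackground etaZ (dilH (2 ^ (j + 1)) y)) x‖
            ≤ 1 * (((2 : ℝ) ^ (j + 1)) ^ k * ‖iteratedFDeriv ℝ k (unitBackground etaZ) (dilH (2 ^ (j + 1)) x)‖) :=
              mul_le_mul (inv_le_one_of_one_le₀ hl) (norm_iteratedFDeriv_comp_dilH_le hB hl k x)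
                (by positivity) zero_le_one
          _ ≤ c * ((2 : ℝ) ^ (j + 1)) ^ k := by
              rw [one_mul, mul_comm]
              exact mul_le_mul_of_nonneg_right (hc _) (by positivity)
    _ ≤ ∑ _j ∈ Finset.range n, c * ((2 : ℝ) ^ n) ^ k := by
        refine Finset.sum_le_sum fun j hj => mul_le_mul_of_nonneg_left ?_ hc0
        exact pow_le_pow_left₀ (by positivity)
          (pow_le_pow_right₀ (by norm_num) (Finset.mem_range.1 hj)) k
    _ = c * (n * ((2 : ℝ) ^ n) ^ k) := by
        rw [Finset.sum_const, Finset.card_range, nsmul_eq_mul]; ring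
    _ ≤ c * ((2 : ℝ) ^ (k + 1)) ^ n := by
        refine mul_le_mul_of_nonneg_left ?_ hc0
        have hn : (n : ℝ) ≤ 2 ^ n := by exact_mod_cast Nat.lt_two_pow_self.le
        calc (n : ℝ) * ((2 : ℝ) ^ n) ^ k ≤ 2 ^ n * ((2 : ℝ) ^ n) ^ k :=
              mul_le_mul_of_nonneg_right hn (by positivity)
          _ = ((2 : ℝ) ^ (k + 1)) ^ n := by
              rw [← pow_mul, ← pow_add, ← pow_mul]; ring

/-! ## The three background quantities entering the log door -/

/-- `G_n` is supported in the closed ball of radius `2`. [folklore] -/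
theorem tsupport_background_subset (n : ℕ) : tsupport (background n etaZ) ⊆ Metric.closedBall 0 2 := by
  have h := tsupport_subset (r := 1 / 4) (by norm_num) le_rfl 0 n 1 0
  simpa using h

/-- Off the ball of radius `2` every `y` lies outside the support of `G_n`. [folklore] -/
theorem notMem_tsupport_background {n : ℕ} {y : E3} (hy : 2 < ‖y‖) : y ∉ tsupport (background n etaZ) := by
  intro h
  have := tsupport_background_subset n h
  rw [Metric.mem_closedBall, dist_zero_right] at this
  linarith

/-- **`∫‖ΔG_n‖² ≤ κ · 64ⁿ`.** [folklore] -/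
theorem background_laplacianNormSq_le : ∃ κ : ℝ, 0 ≤ κ ∧ ∀ n : ℕ,
    (∫ y, ‖Δ (background n etaZ) y‖ ^ 2) ≤ κ * 64 ^ n := by
  obtain ⟨c, hc0, hc⟩ := norm_iteratedFDeriv_background_le 2
  refine ⟨9 * c ^ 2 * volBall 2, by have := volBall_nonneg 2; positivity, fun n => ?_⟩
  have hG := contDiff_background (n := n) etaZ_contDiff
  have h8 : ((2 : ℝ) ^ (2 + 1)) ^ n = 8 ^ n := by norm_num
  have hpt : ∀ y, ‖Δ (background n etaZ) y‖ ^ 2 ≤ 9 * c ^ 2 * 64 ^ n := by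
    intro y
    have h1 := (norm_laplacian_le hG y).trans (mul_le_mul_of_nonneg_left (hc n y) (by norm_num))
    rw [h8] at h1
    have h64 : (64 : ℝ) ^ n = 8 ^ n * 8 ^ n := by rw [← mul_pow]; norm_num
    calc ‖Δ (background n etaZ) y‖ ^ 2 ≤ (3 * (c * 8 ^ n)) ^ 2 := pow_le_pow_left₀ (norm_nonneg _) h1 2
      _ = 9 * c ^ 2 * 64 ^ n := by rw [h64]; ring
  calc (∫ y, ‖Δ (background n etaZ) y‖ ^ 2) ≤ 9 * c ^ 2 * 64 ^ n * volBall 2 :=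
        integral_le_of_le_of_ball (fun y => sq_nonneg _) hpt fun y hy => by
          rw [laplacian_eq_zero_of_notMem_tsupport (notMem_tsupport_background hy), norm_zero,
            zero_pow two_ne_zero]
    _ = 9 * c ^ 2 * volBall 2 * 64 ^ n := by ring

/-- **`∫ Σᵢ ‖∂ᵢΔG_n‖² ≤ κ · 256ⁿ`.** [folklore] -/
theorem background_gradLaplacianNormSq_le : ∃ κ : ℝ, 0 ≤ κ ∧ ∀ n : ℕ,
    (∫ y, ∑ i, ‖fderiv ℝ (Δ (background n etaZ)) y (EuclideanSpace.single i 1)‖ ^ 2) ≤ κ * 256 ^ n := by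
  obtain ⟨c, hc0, hc⟩ := norm_iteratedFDeriv_background_le 3
  refine ⟨27 * c ^ 2 * volBall 2, by have := volBall_nonneg 2; positivity, fun n => ?_⟩
  have hG := contDiff_background (n := n) etaZ_contDiff
  have h16 : ((2 : ℝ) ^ (3 + 1)) ^ n = 16 ^ n := by norm_num
  have hpt : ∀ y, ∑ i, ‖fderiv ℝ (Δ (background n etaZ)) y (EuclideanSpace.single i 1)‖ ^ 2 ≤
      27 * c ^ 2 * 256 ^ n := by
    intro y
    have h1 := hc n y
    rw [h16] at h1
    have h256 : (256 : ℝ) ^ n = 16 ^ n * 16 ^ n := by rw [← mul_pow]; norm_num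
    calc ∑ i, ‖fderiv ℝ (Δ (background n etaZ)) y (EuclideanSpace.single i 1)‖ ^ 2
        ≤ 27 * ‖iteratedFDeriv ℝ 3 (background n etaZ) y‖ ^ 2 := sum_norm_fderiv_laplacian_sq_le hG y
      _ ≤ 27 * (c * 16 ^ n) ^ 2 := by gcongr
      _ = 27 * c ^ 2 * 256 ^ n := by rw [h256]; ring
  calc (∫ y, ∑ i, ‖fderiv ℝ (Δ (background n etaZ)) y (EuclideanSpace.single i 1)‖ ^ 2)
      ≤ 27 * c ^ 2 * 256 ^ n * volBall 2 :=
        integral_le_of_le_of_ball (fun y => Finset.sum_nonneg fun _ _ => sq_nonneg _) hpt fun y hy => by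
          have h0 : y ∉ tsupport (Δ (background n etaZ)) := fun h =>
            notMem_tsupport_background hy (tsupport_laplacian_subset' _ h)
          simp [fderiv_of_notMem_tsupport ℝ h0]
    _ = 27 * c ^ 2 * volBall 2 * 256 ^ n := by ring

/-- **`|P₂(G_n)| = |∫⟪DG_n(G_n), Δ²G_n⟫| ≤ κ · 256ⁿ`.** [folklore] -/
theorem background_production2_abs_le : ∃ κ : ℝ, 0 ≤ κ ∧ ∀ n : ℕ,
    |∫ y, ⟪fderiv ℝ (background n etaZ) y (background n etaZ y), Δ (Δ (background n etaZ)) y⟫| ≤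
      κ * 256 ^ n := by
  obtain ⟨c₀, hc₀, h₀⟩ := norm_iteratedFDeriv_background_le 0
  obtain ⟨c₁, hc₁, h₁⟩ := norm_iteratedFDeriv_background_le 1
  obtain ⟨c₄, hc₄, h₄⟩ := norm_iteratedFDeriv_background_le 4
  refine ⟨9 * c₀ * c₁ * c₄ * volBall 2, by have := volBall_nonneg 2; positivity, fun n => ?_⟩
  have hG := contDiff_background (n := n) etaZ_contDiff
  have e0 : ((2 : ℝ) ^ (0 + 1)) ^ n = 2 ^ n := by norm_num
  have e1 : ((2 : ℝ) ^ (1 + 1)) ^ n = 4 ^ n := by norm_num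
  have e4 : ((2 : ℝ) ^ (4 + 1)) ^ n = 32 ^ n := by norm_num
  have h256 : (256 : ℝ) ^ n = 4 ^ n * 2 ^ n * 32 ^ n := by rw [← mul_pow, ← mul_pow]; norm_num
  have hpt : ∀ y, |⟪fderiv ℝ (background n etaZ) y (background n etaZ y), Δ (Δ (background n etaZ)) y⟫| ≤
      9 * c₀ * c₁ * c₄ * 256 ^ n := by
    intro y
    have hA := (norm_fderiv_apply_self_le (background n etaZ) y).trans
      (mul_le_mul (h₁ n y) (h₀ n y) (norm_nonneg _) (by positivity))
    have hB := (norm_laplacian2_le hG y).trans (mul_le_mul_of_nonneg_left (h₄ n y) (by norm_num))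
    rw [e0, e1] at hA
    rw [e4] at hB
    calc |⟪fderiv ℝ (background n etaZ) y (background n etaZ y), Δ (Δ (background n etaZ)) y⟫|
        ≤ ‖fderiv ℝ (background n etaZ) y (background n etaZ y)‖ * ‖Δ (Δ (background n etaZ)) y‖ :=
          abs_real_inner_le_norm _ _
      _ ≤ (c₁ * 4 ^ n * (c₀ * 2 ^ n)) * (9 * (c₄ * 32 ^ n)) :=
          mul_le_mul hA hB (norm_nonneg _) (by positivity)
      _ = 9 * c₀ * c₁ * c₄ * 256 ^ n := by rw [h256]; ring
  calc |∫ y, ⟪fderiv ℝ (background n etaZ) y (background n etaZ y), Δ (Δ (background n etaZ)) y⟫|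
      ≤ 9 * c₀ * c₁ * c₄ * 256 ^ n * volBall 2 :=
        abs_integral_le_of_ball hpt fun y hy => by
          rw [image_eq_zero_of_notMem_tsupport (notMem_tsupport_background hy), map_zero, inner_zero_left]
    _ = 9 * c₀ * c₁ * c₄ * volBall 2 * 256 ^ n := by ring

end Sep3

end Summit.NavierStokesRegularity.FunctionalMining

end
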